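import Literature.Computability.AlgebraicComplexity.SmallFormatRankFlag
import HarnessLib

/-!
# ω-census family (a): the rank-one plane cap for every format `⟨c,m,n⟩`

Cell `pub-omega` (unit `pub-omega-lit`, gen 5), topic `Summits/MatrixMultiplication/OmegaCensus`
(sub-folder `SmallFormats`). Framing (verbatim): lottery ticket; floor = certified bounds/negative
ranges. HONEST FRAMING: our elementary structural lemma (the `⟨2,2,n⟩` case is
`RankOnePlaneCap.lean` / `RankOnePlaneCapCol.lean`; motivated by Alekseev 2015, Chebyshevskiĭ Sb. 16:4,
Lemma 7), stated for all formats; a CAP for the structured searches of the census, not a bound on any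
rank, not progress on `ω`.

**Theorem** (`card_vanishing_add_lt`). `k` a field, `c ≥ 2`, `β` a bilinear computation of
`⟨c,m,n⟩ : (X, Y) ↦ XY` (`X ∈ k^{c×m}`, `Y ∈ k^{m×n}`) of length `r = |ι| < 2mn`, `λ ∈ k^c ∖ 0`, `R` a set
of indices whose X-forms vanish on `S^λ = {λ zᵀ : z ∈ k^m}` (the matrices all of whose columns are
multiples of `λ`). Then `|R| + mn + 1 ≤ r` — one better than substitution (`|R| + mn ≤ r`: the survivors
of `X ↦ λ zᵀ` compute `λ ⊗ (zᵀY) ≅ ⟨1,m,n⟩` of rank `mn`).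
Proof: if `|R| = r − mn`, the `mn` survivors' bilinear forms are linearly independent, so for `θ ⊥ λ`
(exists as `c ≥ 2`) the identity `θᵀ(λ zᵀ Y) = 0` forces `θᵀ w_i = 0` for all survivors; then the
`θ`-row of `XY = ∑ …` is computed by `R` alone, and `(X, Y) ↦ θᵀXY` has Y-flattening rank `mn`, so
`|R| ≥ mn` and `r ≥ 2mn`.

**Transpose dual** (`exists_transposeDual`): a computation of `⟨c,m,n⟩` yields one of `⟨m,c,n⟩` with
X-forms `X' ↦ f_i(X'ᵀ)` (the symmetry `(X,Y,Z) ↦ (Xᵀ,Zᵀ,Yᵀ)`), whence the cap for the planes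
`S_λ = {z λᵀ : z ∈ k^c}` (`λ ∈ k^m ∖ 0`, `m ≥ 2`): `|R| + cn + 1 ≤ r` when `r < 2cn`
(`card_vanishing_col_add_lt`).

Census instances: `⟨2,2,5⟩ @ 17`: `≤ 6` on each rank-one plane of `M₂` (both types);
`⟨2,3,3⟩ @ 14` (the open `𝔽₃` cell `(233, 14)`): `≤ 4` X-forms vanish on each `S^λ = {λ zᵀ : z ∈ k³}`
(substitution: `5`).
-/

namespace Summit.MatrixMultiplication.OmegaCensus.RankOnePlaneCapGeneral

open Module Matrix Literature.Computability.AlgebraicComplexity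

variable {k : Type*} [Field k] {c m n : ℕ} {ι : Type*} [Fintype ι]

/-- `θ ᵥ* (a • W) = a • (θ ᵥ* W)`. -/
theorem vecMul_smul_matrix (θ : Fin c → k) (a : k) (W : Matrix (Fin c) (Fin n) k) :
    θ ᵥ* (a • W) = a • (θ ᵥ* W) := by
  ext ν
  simp [Matrix.vecMul, dotProduct, Finset.mul_sum, mul_left_comm]

omit [Fintype ι] in
/-- `θ ᵥ* (∑ a_i • W_i) = ∑ a_i • (θ ᵥ* W_i)`. -/
theorem vecMul_sum_smul (θ : Fin c → k) (s : Finset ι) (a : ι → k)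
    (W : ι → Matrix (Fin c) (Fin n) k) :
    θ ᵥ* (∑ i ∈ s, a i • W i) = ∑ i ∈ s, a i • (θ ᵥ* W i) := by
  classical
  induction s using Finset.induction_on with
  | empty => simp
  | insert j s hj ih =>
      rw [Finset.sum_insert hj, Finset.sum_insert hj, Matrix.vecMul_add, vecMul_smul_matrix, ih]

/-- `dim k^{m×n} = mn`. -/
theorem finrank_top_matrix : finrank k (⊤ : Submodule k (Matrix (Fin m) (Fin n) k)) = m * n := by
  rw [finrank_top]
  simp [Module.finrank_matrix]

/-- Y-flattening count: if `(λ zᵀ) Y = ∑_{i∈J} a_i(z) g_i(Y) • w'_i` for all `z, Y` with `λ ≠ 0`, then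
the `g_i`, `i ∈ J`, have no common zero `Y ≠ 0`, hence `mn ≤ |J|`. -/
theorem mn_le_card_of_restr (g : ι → Module.Dual k (Matrix (Fin m) (Fin n) k))
    {lam : Fin c → k} (hlam : lam ≠ 0) (J : Finset ι) (a : ι → (Fin m → k) → k)
    (w' : ι → Matrix (Fin c) (Fin n) k)
    (h : ∀ (z : Fin m → k) (Y : Matrix (Fin m) (Fin n) k),
      vecMulVec lam z * Y = ∑ i ∈ J, (a i z * g i Y) • w' i) :
    m * n ≤ J.card := by
  classical
  obtain ⟨κ', hκ'⟩ : ∃ κ, lam κ ≠ 0 := by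
    by_contra h0
    simp only [not_exists, not_not] at h0
    exact hlam (funext h0)
  have key : ∀ Y ∈ (⊤ : Submodule k (Matrix (Fin m) (Fin n) k)), (∀ i ∈ J, g i Y = 0) → Y = 0 := by
    intro Y _ hY
    ext μ ν
    have h1 := h (Pi.single μ 1) Y
    rw [Finset.sum_eq_zero (fun i hi => by rw [hY i hi, mul_zero, zero_smul])] at h1
    have h2 := congrFun (congrFun h1 κ') ν
    simp [Matrix.mul_apply, vecMulVec_apply, Pi.single_apply, hκ'] at h2
    simpa using h2
  have := BilinComp.finrank_le_card_of_forall_eq_zero ⊤ J g key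
  rwa [finrank_top_matrix] at this

/-- **Rank-one plane cap, all formats.** In a bilinear computation of `⟨c,m,n⟩` (`c ≥ 2`) of length
`< 2mn`, a set `R` of indices whose X-forms vanish on `{λ zᵀ : z ∈ k^m}` (`λ ≠ 0`) has
`|R| + mn + 1 ≤ |ι|`. -/
theorem card_vanishing_add_lt (hc : 2 ≤ c) (hr : Fintype.card ι < 2 * (m * n))
    (β : BilinComp (mulBilin k c m n) ι) {lam : Fin c → k} (hlam : lam ≠ 0) (R : Finset ι)
    (hR : ∀ i ∈ R, ∀ z : Fin m → k, β.f i (vecMulVec lam z) = 0) :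
    R.card + m * n + 1 ≤ Fintype.card ι := by
  classical
  set N := m * n with hN
  by_contra hlt
  rw [not_le] at hlt
  set Rc : Finset ι := Finset.univ \ R with hRc
  have hcardR : Rc.card + R.card = Fintype.card ι := by
    rw [hRc, Finset.card_sdiff_add_card_eq_card (Finset.subset_univ R), Finset.card_univ]
  -- (A1) restriction to `X = λ zᵀ` kills the terms of `R`
  have A1 : ∀ (z : Fin m → k) (Y : Matrix (Fin m) (Fin n) k), vecMulVec lam z * Y =
      ∑ i ∈ Rc, (β.f i (vecMulVec lam z) * β.g i Y) • β.w i := by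
    intro z Y
    have h := β.map_eq_sum (vecMulVec lam z) Y
    rw [mulBilin_apply] at h
    rw [h, ← Finset.sum_sdiff (Finset.subset_univ R), add_eq_left]
    exact Finset.sum_eq_zero fun i hi => by rw [hR i hi, zero_mul, zero_smul]
  -- (A2) the survivors are exactly `mn`
  have A2 : N ≤ Rc.card :=
    mn_le_card_of_restr β.g hlam Rc (fun i z => β.f i (vecMulVec lam z)) β.w A1
  have hRc2 : Rc.card = N := by omega
  -- (A3) the surviving bilinear forms are linearly independent
  have A3 : ∀ e : ι → k, (∀ (z : Fin m → k) (Y : Matrix (Fin m) (Fin n) k),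
      ∑ i ∈ Rc, e i * (β.f i (vecMulVec lam z) * β.g i Y) = 0) → ∀ i ∈ Rc, e i = 0 := by
    intro e he
    by_contra hne
    simp only [not_forall, exists_prop] at hne
    obtain ⟨i0, hi0, he0⟩ := hne
    set J : Finset ι := Rc.erase i0 with hJ
    have hJc : J.card = N - 1 := by rw [hJ, Finset.card_erase_of_mem hi0, hRc2]
    have hid : ∀ (z : Fin m → k) (Y : Matrix (Fin m) (Fin n) k), vecMulVec lam z * Y =
        ∑ i ∈ J, (β.f i (vecMulVec lam z) * β.g i Y) • (β.w i - (e i / e i0) • β.w i0) := by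
      intro z Y
      set t : ι → k := fun i => β.f i (vecMulVec lam z) * β.g i Y with ht
      have e1 : vecMulVec lam z * Y = t i0 • β.w i0 + ∑ i ∈ J, t i • β.w i := by
        rw [A1 z Y, hJ, Finset.add_sum_erase Rc (fun i => t i • β.w i) hi0]
      have e2 : e i0 * t i0 + ∑ i ∈ J, e i * t i = 0 := by
        rw [hJ, Finset.add_sum_erase Rc (fun i => e i * t i) hi0]
        exact he z Y
      have e4 : t i0 = -(∑ i ∈ J, (e i / e i0) * t i) := by
        have h6 : t i0 = (e i0)⁻¹ * (e i0 * t i0) := by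
          rw [← mul_assoc, inv_mul_cancel₀ he0, one_mul]
        rw [h6, eq_neg_of_add_eq_zero_left e2, mul_neg, Finset.mul_sum]
        congr 1
        refine Finset.sum_congr rfl fun i _ => ?_
        rw [div_eq_mul_inv]
        ring
      calc vecMulVec lam z * Y = t i0 • β.w i0 + ∑ i ∈ J, t i • β.w i := e1
        _ = ∑ i ∈ J, (t i • β.w i - ((e i / e i0) * t i) • β.w i0) := by
            rw [e4, Finset.sum_sub_distrib, ← Finset.sum_smul, neg_smul]
            abel
        _ = ∑ i ∈ J, t i • (β.w i - (e i / e i0) • β.w i0) :=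
            Finset.sum_congr rfl fun i _ => by rw [smul_sub, smul_smul, mul_comm]
    have hmn := mn_le_card_of_restr β.g hlam J (fun i z => β.f i (vecMulVec lam z))
      (fun i => β.w i - (e i / e i0) • β.w i0) hid
    omega
  -- an output functional `θ ⊥ λ` with a nonzero coordinate (uses `c ≥ 2`)
  obtain ⟨κ₁, hκ₁⟩ : ∃ κ, lam κ ≠ 0 := by
    by_contra h0
    simp only [not_exists, not_not] at h0
    exact hlam (funext h0)
  obtain ⟨κ₂, hκ₂⟩ : ∃ κ : Fin c, κ ≠ κ₁ := by
    by_cases h0 : κ₁ = ⟨0, by omega⟩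
    · exact ⟨⟨1, by omega⟩, fun h => by rw [h0] at h; exact absurd (congrArg Fin.val h) (by simp)⟩
    · exact ⟨⟨0, by omega⟩, fun h => h0 h.symm⟩
  set θ : Fin c → k := Pi.single κ₂ (lam κ₁) - Pi.single κ₁ (lam κ₂) with hθ
  have hθdot : θ ⬝ᵥ lam = 0 := by
    rw [hθ, sub_dotProduct, single_dotProduct, single_dotProduct]
    ring
  have hθlam : ∀ z : Fin m → k, θ ᵥ* vecMulVec lam z = 0 := by
    intro z
    ext μ
    have : (θ ᵥ* vecMulVec lam z) μ = (θ ⬝ᵥ lam) * z μ := by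
      simp [Matrix.vecMul, dotProduct, vecMulVec_apply, Finset.sum_mul, mul_assoc]
    rw [this, hθdot, zero_mul, Pi.zero_apply]
  have hκ' : θ κ₂ ≠ 0 := by
    rw [hθ, Pi.sub_apply, Pi.single_eq_same, Pi.single_eq_of_ne hκ₂, sub_zero]
    exact hκ₁
  -- (A4) the outputs of the survivors have zero `θ`-row
  have A4 : ∀ i ∈ Rc, θ ᵥ* β.w i = 0 := by
    intro i hi
    ext ν
    have hc := A3 (fun j => (θ ᵥ* β.w j) ν) ?_ i hi
    · simpa using hc
    · intro z Y
      have h1 : θ ᵥ* (vecMulVec lam z * Y) =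
          θ ᵥ* ∑ i ∈ Rc, (β.f i (vecMulVec lam z) * β.g i Y) • β.w i := by rw [A1 z Y]
      rw [← Matrix.vecMul_vecMul, hθlam z, Matrix.zero_vecMul, vecMul_sum_smul] at h1
      have h2 := congrFun h1 ν
      rw [Pi.zero_apply, Finset.sum_apply] at h2
      refine Eq.trans (Finset.sum_congr rfl fun j _ => ?_) h2.symm
      simp [mul_comm]
  -- (A5) the `R`-terms alone compute `(X, Y) ↦ θᵀ X Y`, whose Y-flattening has rank `mn`
  have A5 : N ≤ R.card := by
    have key : ∀ Y ∈ (⊤ : Submodule k (Matrix (Fin m) (Fin n) k)),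
        (∀ i ∈ R, β.g i Y = 0) → Y = 0 := by
      intro Y _ hY
      ext μ ν
      have h := β.map_eq_sum (Matrix.single κ₂ μ (1 : k)) Y
      rw [mulBilin_apply] at h
      have hR0 : θ ᵥ* (∑ i, (β.f i (Matrix.single κ₂ μ (1 : k)) * β.g i Y) • β.w i) = 0 := by
        rw [vecMul_sum_smul]
        refine Finset.sum_eq_zero fun i _ => ?_
        by_cases hiR : i ∈ R
        · rw [hY i hiR, mul_zero, zero_smul]
        · rw [A4 i (Finset.mem_sdiff.2 ⟨Finset.mem_univ i, hiR⟩), smul_zero]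
      have h1 : θ ᵥ* (Matrix.single κ₂ μ (1 : k) * Y) = 0 := by rw [h]; exact hR0
      have h2 := congrFun h1 ν
      simp [Matrix.vecMul, dotProduct, single_mul_apply', hκ'] at h2
      exact h2
    have := BilinComp.finrank_le_card_of_forall_eq_zero ⊤ R β.g key
    rwa [finrank_top_matrix] at this
  omega

/-- Cap form: with `r = |ι| < 2mn`, at most `r − mn − 1` X-forms vanish on `{λ zᵀ}`. -/
theorem card_vanishing_le (hc : 2 ≤ c) (hr : Fintype.card ι < 2 * (m * n))
    (β : BilinComp (mulBilin k c m n) ι) {lam : Fin c → k} (hlam : lam ≠ 0) (R : Finset ι)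
    (hR : ∀ i ∈ R, ∀ z : Fin m → k, β.f i (vecMulVec lam z) = 0) :
    R.card ≤ Fintype.card ι - m * n - 1 := by
  have := card_vanishing_add_lt hc hr β hlam R hR
  omega

/-- **Transpose-dual computation** `⟨c,m,n⟩ → ⟨m,c,n⟩`: from `β` computing `XY` build the computation of
`X'Y'` (`X' ∈ k^{m×c}`, `Y' ∈ k^{c×n}`) with X-forms `X' ↦ f_i(X'ᵀ)`, Y-forms `Y' ↦ ∑ w_i κ ν · Y' κ ν`
and outputs `G_i μ ν = g_i(E_{μν})` — the symmetry `(X, Y, Z) ↦ (Xᵀ, Zᵀ, Yᵀ)`. -/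
theorem exists_transposeDual (β : BilinComp (mulBilin k c m n) ι) :
    ∃ β' : BilinComp (mulBilin k m c n) ι, ∀ i X', β'.f i X' = β.f i X'ᵀ := by
  classical
  refine ⟨{ f := fun i =>
              { toFun := fun X' => β.f i X'ᵀ
                map_add' := fun X X' => by rw [Matrix.transpose_add, map_add]
                map_smul' := fun a X => by rw [Matrix.transpose_smul, map_smul]; rfl }
            g := fun i =>
              { toFun := fun Y' => ∑ κ, ∑ ν, β.w i κ ν * Y' κ ν
                map_add' := fun Y Y' => by
                  simp only [Matrix.add_apply, mul_add, Finset.sum_add_distrib]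
                map_smul' := fun a Y => by
                  simp only [Matrix.smul_apply, smul_eq_mul, RingHom.id_apply, Finset.mul_sum]
                  exact Finset.sum_congr rfl fun κ _ => Finset.sum_congr rfl fun ν _ => by ring }
            w := fun i => Matrix.of fun μ ν => β.g i (Matrix.single μ ν (1 : k))
            map_eq_sum := ?_ }, fun i X' => rfl⟩
  intro X' Y'
  rw [mulBilin_apply]
  ext a b
  have hβ : ∀ κ ν, (∑ i, (β.f i X'ᵀ * β.g i (Matrix.single a b (1 : k))) * β.w i κ ν)
      = if ν = b then X' a κ else 0 := by
    intro κ ν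
    have h := β.map_eq_sum X'ᵀ (Matrix.single a b (1 : k))
    rw [mulBilin_apply] at h
    have h2 := congrFun (congrFun h κ) ν
    rw [mul_single_apply', Matrix.transpose_apply] at h2
    rw [h2, Matrix.sum_apply]
    exact Finset.sum_congr rfl fun i _ => by simp
  simp only [LinearMap.coe_mk, AddHom.coe_mk, Matrix.sum_apply, Matrix.smul_apply, Matrix.of_apply,
    smul_eq_mul]
  calc (X' * Y') a b = ∑ κ, X' a κ * Y' κ b := Matrix.mul_apply
    _ = ∑ κ, ∑ ν, Y' κ ν * (if ν = b then X' a κ else 0) := by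
        refine Finset.sum_congr rfl fun κ _ => ?_
        simp [mul_comm]
    _ = ∑ κ, ∑ ν, Y' κ ν * ∑ i, (β.f i X'ᵀ * β.g i (Matrix.single a b (1 : k))) * β.w i κ ν := by
        simp_rw [hβ]
    _ = ∑ κ, ∑ ν, ∑ i, Y' κ ν * ((β.f i X'ᵀ * β.g i (Matrix.single a b (1 : k))) * β.w i κ ν) := by
        simp_rw [Finset.mul_sum]
    _ = ∑ κ, ∑ i, ∑ ν, Y' κ ν * ((β.f i X'ᵀ * β.g i (Matrix.single a b (1 : k))) * β.w i κ ν) :=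
        Finset.sum_congr rfl fun κ _ => Finset.sum_comm
    _ = ∑ i, ∑ κ, ∑ ν, Y' κ ν * ((β.f i X'ᵀ * β.g i (Matrix.single a b (1 : k))) * β.w i κ ν) :=
        Finset.sum_comm
    _ = ∑ i, (β.f i X'ᵀ * ∑ κ, ∑ ν, β.w i κ ν * Y' κ ν) * β.g i (Matrix.single a b (1 : k)) := by
        refine Finset.sum_congr rfl fun i _ => ?_
        rw [Finset.mul_sum, Finset.sum_mul]
        refine Finset.sum_congr rfl fun κ _ => ?_
        rw [Finset.mul_sum, Finset.sum_mul]
        exact Finset.sum_congr rfl fun ν _ => by ring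

/-- **Column-plane cap, all formats.** In a bilinear computation of `⟨c,m,n⟩` (`m ≥ 2`) of length
`< 2cn`, a set `R` of indices whose X-forms vanish on `{z λᵀ : z ∈ k^c}` (`λ ∈ k^m ∖ 0`; the matrices
all of whose rows are multiples of `λᵀ`) has `|R| + cn + 1 ≤ |ι|`. -/
theorem card_vanishing_col_add_lt (hm : 2 ≤ m) (hr : Fintype.card ι < 2 * (c * n))
    (β : BilinComp (mulBilin k c m n) ι) {lam : Fin m → k} (hlam : lam ≠ 0) (R : Finset ι)
    (hR : ∀ i ∈ R, ∀ z : Fin c → k, β.f i (vecMulVec z lam) = 0) :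
    R.card + c * n + 1 ≤ Fintype.card ι := by
  obtain ⟨β', hβ'⟩ := exists_transposeDual β
  refine card_vanishing_add_lt hm hr β' hlam R fun i hi z => ?_
  rw [hβ', Matrix.transpose_vecMulVec]
  exact hR i hi z

/-- **Census instance `⟨2,3,3⟩ @ 14`** (the open `𝔽₃` cell `(233, 14)`, valid over every field): in a
14-term bilinear algorithm for `⟨2,3,3⟩`, at most `4` X-forms vanish on a plane
`{λ zᵀ : z ∈ k³} ⊂ k^{2×3}` (substitution alone: `5`). -/
theorem card_vanishing_le_four_233 {ι : Type*} [Fintype ι] (h14 : Fintype.card ι = 14)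
    (β : BilinComp (mulBilin k 2 3 3) ι) {lam : Fin 2 → k} (hlam : lam ≠ 0) (R : Finset ι)
    (hR : ∀ i ∈ R, ∀ z : Fin 3 → k, β.f i (vecMulVec lam z) = 0) : R.card ≤ 4 := by
  have := card_vanishing_add_lt (le_refl 2) (by rw [h14]; norm_num) β hlam R hR
  omega

/-- **Census instance `⟨2,2,5⟩ @ 17`**, both plane types at once: at most `6` X-forms vanish on
`{λ zᵀ}` and at most `6` on `{z λᵀ}` in a 17-term algorithm (substitution: `7`). -/
theorem card_vanishing_le_six_225 {ι : Type*} [Fintype ι] (h17 : Fintype.card ι = 17)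
    (β : BilinComp (mulBilin k 2 2 5) ι) {lam : Fin 2 → k} (hlam : lam ≠ 0) (R R' : Finset ι)
    (hR : ∀ i ∈ R, ∀ z : Fin 2 → k, β.f i (vecMulVec lam z) = 0)
    (hR' : ∀ i ∈ R', ∀ z : Fin 2 → k, β.f i (vecMulVec z lam) = 0) :
    R.card ≤ 6 ∧ R'.card ≤ 6 := by
  have h1 := card_vanishing_add_lt (le_refl 2) (by rw [h17]; norm_num) β hlam R hR
  have h2 := card_vanishing_col_add_lt (le_refl 2) (by rw [h17]; norm_num) β hlam R' hR'
  constructor <;> omega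

end Summit.MatrixMultiplication.OmegaCensus.RankOnePlaneCapGeneral
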